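import Literature.NumberTheory.GaloisCohomology.Howard2004.KolyvaginSystemScalars
import HarnessLib

/-!
# Howard 2004, Def. 1.2.3: a unit rescaling of the finite–singular slot transports Kolyvagin systems

Topic `NumberTheory/GaloisCohomology/Howard2004`; theorems only (no definition, no named fact, no
`sorry`).  Sequel to `KolyvaginSystemScalars` (the scalars on the level Selmer groups, on the
Kolyvagin classes and on `H¹_s ⊗ G_ℓ`; the relation `IsRescaledFs`) and to lit's
`FiniteSingularNatural` (reading note (v): why the pinned slot is print-exact).  Cell
`pub/bsd-print-x9`, x9-p1 LEAD ruling 2026-08-28 «(n2)»: the kernel half of the certificate.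

* `upperPath_smul` / `lowerPath_smul` — the two paths of display (ks relations) are `R`-linear:
  upper(`r · y`) `= ((r•) ⊗ 1 ⊗ 1)` upper(`y`) (reduction and localisation commute with the scalars,
  the slot is natural along the scalars on the finite classes, and `loc_ℓ red y` IS a finite class),
  lower(`r · z`) `= ((r•) ⊗ 1 ⊗ 1)` lower(`z`).
* `upperPath_of_isRescaledFs` / `lowerPath_with_fs` — replacing the slot `fs` by `fs₂ = u_ℓ · fs`
  rescales the upper path by `u_ℓ` and leaves the lower path alone.
* **`isKolyvaginSystem_smulClasses_of_isRescaledFs`**, **`smulClasses_mem_KS_of_isRescaledFs`** —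
  if `κ` satisfies (ks relations) for `fs₂ = u · fs` then `κ″_n := (∏_{ℓ ∣ n} w_ℓ) κ_n` satisfies
  them for `fs` (`w_ℓ u_ℓ = 1`): upper(`c_n κ_n`) `= c_n` upper(`κ_n`) and lower(`c_{nℓ} κ_{nℓ}`)
  `= c_{nℓ} u_ℓ` upper(`κ_n`) with `c_{nℓ} u_ℓ = c_n w_ℓ u_ℓ = c_n`; and `κ″ ∈ KS` when `κ ∈ KS`.
* `smulClasses_prod_empty` — `κ″_1 = κ_1` (so the conclusion of Thm. 1.6.1, which mentions only
  `κ_1`, is insensitive to the rescaling).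
* §4, all levels: `IsScalarLinear.of_isScalarTower` / `scalarMapH1_algebraMap` (the `R`-scalars
  through `R → R_k`), `DVRSetting.rqH1_scalarMapH1` (the reductions `T^{(k+1)}/I_n → T^{(k)}/I_n`
  commute with the level-independent scalars), and
  **`DVRSetting.exists_kolyvaginSystem_smul_of_isRescaledFs`**: the data of a Kolyvagin system of
  «`S` with slots `fs₂ = u_ℓ · fs`» (`u_ℓ ∈ R` read in every `R_k`, `w_ℓ u_ℓ = 1`) rescales to a
  `S.KolyvaginSystem` with the same bottom class; `DVRSetting.conclusion_with_fs_iff`: the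
  conclusion of Thm. 1.6.1 does not see the slots.

With (n1) (the canonical `φ^{fs}` of Def. 1.1.8 is admissible) and the commutant lemma
(`UnimodularCommutantScalar`: two admissible slots differ by units on the finite classes) this is
«Thm. 1.6.1 for `φ^{fs}` ⇒ the pinned cite-only fact» of reading note (v).  BSD is not proved by any
of this.

References: B. Howard, *The Heegner point Kolyvagin system*, Compositio Math. 140 (2004),
Def. 1.2.3 with display (ks relations), Thm. 1.7.5 (arXiv:1202.6340 p. 6 L126 – p. 7 L12, p. 14).
-/

set_option autoImplicit false

noncomputable section

open Function NumberField IsDedekindDomain Field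
open scoped NumberField ContRepresentation Classical TensorProduct

namespace Literature.NumberTheory.GaloisCohomology.Howard2004

open Literature.NumberTheory.GaloisRepresentations
open Literature.NumberTheory.GaloisRepresentations.DiscreteGaloisModule
open Literature.NumberTheory.GaloisRepresentations.galoisCohomology

/-- Tensor bookkeeping: `((f ⊗ 1) ⊗ 1) (assoc⁻¹ (a ⊗ y)) = assoc⁻¹ (f a ⊗ y)` for an additive `f` read
`ℤ`-linearly (instance arguments are unified, not synthesized, so that the lemma applies verbatim to
the tree's `H¹_s ⊗ G_ℓ ⊗ G_n`). [folklore] -/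
private theorem map_map_id_assoc_symm_tmul {A A' B C : Type} [AddCommGroup A] [AddCommGroup A']
    {_ : AddCommMonoid B} {_ : AddCommMonoid C} {_ : Module ℤ B} {_ : Module ℤ C}
    (f : A →+ A') (a : A) (y : B ⊗[ℤ] C) :
    TensorProduct.map (TensorProduct.map f.toIntLinearMap LinearMap.id) LinearMap.id
        ((TensorProduct.assoc ℤ A B C).symm (a ⊗ₜ[ℤ] y)) =
      (TensorProduct.assoc ℤ A' B C).symm (f a ⊗ₜ[ℤ] y) := by
  rw [TensorProduct.map_map_assoc_symm, TensorProduct.map_tmul, TensorProduct.map_id,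
    LinearMap.id_apply]
  rfl


namespace LevelData

variable {K : Type} [Field K] [NumberField K] {M : Type} [AddCommGroup M] [TopologicalSpace M]
  [DiscreteTopology M] {R : Type} [CommRing R] [Module R M]
  {p : ℕ} [Fact p.Prime] {ρ : DiscreteGaloisModule K M} {t : SelmerTriple p ρ}
  {N : Finset (HeightOneSpectrum (𝓞 K)) → Type} [∀ n, AddCommGroup (N n)]
  [∀ n, TopologicalSpace (N n)] [∀ n, DiscreteTopology (N n)] [∀ n, Module R (N n)]

/-! ## 3. A unit rescaling of the finite–singular slot transports Kolyvagin systems -/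

/-- **Upper path of a rescaled class**: `(φ^{fs}_ℓ ⊗ 1)(loc_ℓ red (r · y)) = ((r•) ⊗ 1 ⊗ 1) (…y…)`
for `y ∈ H¹_{F(n)}(K, T/I_nT) ⊗ G_n`, `ℓ ∤ n`, `ℓ ∈ 𝓛` — reduction and localisation are `R`-linear and
the slot is natural along the scalars on the finite classes, which is where `loc_ℓ red y` lies.
[cite: Howard2004HeegnerKolyvagin, Def. 1.2.3, display (ks relations) (arXiv p. 6, L126–140)] -/
theorem upperPath_smul (D : LevelData R ρ t N) (jbar : AlgebraicClosure K →+* ℂ)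
    (hρ : ρ.IsScalarLinear R) (hst : D.IsSelmerScalarStable jbar hρ)
    {n : Finset (HeightOneSpectrum (𝓞 K))} {v : HeightOneSpectrum (𝓞 K)} (hv : v ∉ n)
    (hvP : v ∈ t.primes) (hnat : D.FsScalarNaturalAt hρ (insert v n) v) (r : R)
    (y : ↥(D.selmerAt jbar n) ⊗[ℤ] Gn (K := K) n) :
    D.upperPath jbar n v
        (TensorProduct.map (D.selmerAtSMul jbar hρ hst n r).toIntLinearMap LinearMap.id y) =
      TensorProduct.map (D.sqSMul hρ (insert v n) v r) LinearMap.id (D.upperPath jbar n v y) := by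
  induction y using TensorProduct.induction_on with
  | zero => simp only [map_zero]
  | add y z hy hz => simp only [map_add, hy, hz]
  | tmul x g =>
    change D.fs (insert v n) v (galoisCohomology.localization (D.ρq (insert v n)) (Sum.inr v) 1
        (D.redH1 n v ((D.selmerAtSMul jbar hρ hst n r x : ↥(D.selmerAt jbar n)) :
          galoisCohomology (D.ρq n) 1))) ⊗ₜ[ℤ] g =
      D.sqSMul hρ (insert v n) v r (D.fs (insert v n) v
        (galoisCohomology.localization (D.ρq (insert v n)) (Sum.inr v) 1
          (D.redH1 n v (x : galoisCohomology (D.ρq n) 1)))) ⊗ₜ[ℤ] g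
    rw [coe_selmerAtSMul, D.redH1_scalarMapH1 hρ, localization_scalarMapH1' (D.isScalarLinear hρ _),
      hnat r _ (D.localization_redH1_mem_unramifiedSubgroup jbar hv hvP x.2)]

/-- **Lower path of a rescaled class**: `loc^s_ℓ (r · z) ⊗ … = ((r•) ⊗ 1 ⊗ 1)(loc^s_ℓ z ⊗ …)` for
`z ∈ H¹_{F(nℓ)}(K, T/I_{nℓ}T) ⊗ G_{nℓ}` (localisation and the singular projection are `R`-linear).
[cite: Howard2004HeegnerKolyvagin, Def. 1.2.3, display (ks relations) (arXiv p. 6, L126–140)] -/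
theorem lowerPath_smul (D : LevelData R ρ t N) (jbar : AlgebraicClosure K →+* ℂ)
    (hρ : ρ.IsScalarLinear R) (hst : D.IsSelmerScalarStable jbar hρ)
    {n : Finset (HeightOneSpectrum (𝓞 K))} {v : HeightOneSpectrum (𝓞 K)} (hv : v ∉ n) (r : R)
    (z : ↥(D.selmerAt jbar (insert v n)) ⊗[ℤ] Gn (K := K) (insert v n)) :
    D.lowerPath jbar n v hv
        (TensorProduct.map (D.selmerAtSMul jbar hρ hst (insert v n) r).toIntLinearMap LinearMap.id z) =
      TensorProduct.map (D.sqSMul hρ (insert v n) v r) LinearMap.id (D.lowerPath jbar n v hv z) := by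
  induction z using TensorProduct.induction_on with
  | zero => simp only [map_zero]
  | add y z hy hz => simp only [map_add, hy, hz]
  | tmul x g =>
    have h1 : singularMap (GaloisRep.toLocal v (D.ρq (insert v n)))
          (galoisCohomology.localization (D.ρq (insert v n)) (Sum.inr v) 1
            ((D.selmerAtSMul jbar hρ hst (insert v n) r x : ↥(D.selmerAt jbar (insert v n))) :
              galoisCohomology (D.ρq (insert v n)) 1)) =
        singularQuotientMap (D.ρq (insert v n)) (D.ρq (insert v n)) v
          (r • LinearMap.id : N (insert v n) →ₗ[R] N (insert v n)).toAddMonoidHom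
          (smul_id_toLocal (D.isScalarLinear hρ (insert v n)) v r)
          (singularMap (GaloisRep.toLocal v (D.ρq (insert v n)))
            (galoisCohomology.localization (D.ρq (insert v n)) (Sum.inr v) 1
              (x : galoisCohomology (D.ρq (insert v n)) 1))) :=
      (apply_localization_scalarMapH1 (D.isScalarLinear hρ (insert v n)) v
          (singularMap (GaloisRep.toLocal v (D.ρq (insert v n)))) r _).trans
        (singularQuotientMap_singularMap _ _ v _ _ _).symm
    have h2 := congrArg (fun s => (TensorProduct.assoc ℤ
        (SingularQuotient (GaloisRep.toLocal v (D.ρq (insert v n)))) (Gell v) (Gn (K := K) n)).symm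
          (s ⊗ₜ[ℤ] TensorProduct.comm ℤ _ _ (gnInsertEquiv v n hv g))) h1
    refine h2.trans ?_
    change _ = TensorProduct.map (D.sqSMul hρ (insert v n) v r) LinearMap.id
        ((TensorProduct.assoc ℤ _ _ _).symm
          (singularMap (GaloisRep.toLocal v (D.ρq (insert v n)))
            (galoisCohomology.localization (D.ρq (insert v n)) (Sum.inr v) 1
              (x : galoisCohomology (D.ρq (insert v n)) 1)) ⊗ₜ[ℤ]
            TensorProduct.comm ℤ _ _ (gnInsertEquiv v n hv g)))
    rw [sqSMul_def]
    exact (map_map_id_assoc_symm_tmul _ _ _).symm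

/-- With the rescaled slot the upper path is rescaled and the lower path is unchanged.
[cite: Howard2004HeegnerKolyvagin, Def. 1.2.3, display (ks relations) (arXiv p. 6, L126–140)] -/
theorem upperPath_of_isRescaledFs (D : LevelData R ρ t N) (jbar : AlgebraicClosure K →+* ℂ)
    (hρ : ρ.IsScalarLinear R)
    {fs₂ : ∀ (n : Finset (HeightOneSpectrum (𝓞 K))) (v : HeightOneSpectrum (𝓞 K)),
      galoisCohomology ((D.ρq n).toLocal (Sum.inr v)) 1 →+
        SingularQuotient (GaloisRep.toLocal v (D.ρq n)) ⊗[ℤ] Gell v}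
    {u : HeightOneSpectrum (𝓞 K) → R} (hrel : D.IsRescaledFs hρ fs₂ u)
    {n : Finset (HeightOneSpectrum (𝓞 K))} {v : HeightOneSpectrum (𝓞 K)} (hv : v ∉ n)
    (hn : insert v n ∈ t.levelSet) (y : ↥(D.selmerAt jbar n) ⊗[ℤ] Gn (K := K) n) :
    ({ D with fs := fs₂ } : LevelData R ρ t N).upperPath jbar n v y =
      TensorProduct.map (D.sqSMul hρ (insert v n) v (u v)) LinearMap.id (D.upperPath jbar n v y) := by
  have hvP : v ∈ t.primes := mem_primes_of_insert_mem_levelSet hn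
  have key : ({ D with fs := fs₂ } : LevelData R ρ t N).upperPath jbar n v =
      TensorProduct.map (D.sqSMul hρ (insert v n) v (u v)) LinearMap.id ∘ₗ D.upperPath jbar n v := by
    refine TensorProduct.ext' fun x g => ?_
    change fs₂ (insert v n) v (galoisCohomology.localization (D.ρq (insert v n)) (Sum.inr v) 1
        (D.redH1 n v (x : galoisCohomology (D.ρq n) 1))) ⊗ₜ[ℤ] g =
      D.sqSMul hρ (insert v n) v (u v) (D.fs (insert v n) v
        (galoisCohomology.localization (D.ρq (insert v n)) (Sum.inr v) 1
          (D.redH1 n v (x : galoisCohomology (D.ρq n) 1)))) ⊗ₜ[ℤ] g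
    rw [hrel n v hv hn _ (D.localization_redH1_mem_unramifiedSubgroup jbar hv hvP x.2)]
  exact LinearMap.congr_fun key y

/-- (the lower path does not involve the slot) [cite: Howard2004HeegnerKolyvagin, Def. 1.2.3, display (ks relations) (arXiv p. 6, L126–140)] -/
theorem lowerPath_with_fs (D : LevelData R ρ t N) (jbar : AlgebraicClosure K →+* ℂ)
    (fs₂ : ∀ (n : Finset (HeightOneSpectrum (𝓞 K))) (v : HeightOneSpectrum (𝓞 K)),
      galoisCohomology ((D.ρq n).toLocal (Sum.inr v)) 1 →+
        SingularQuotient (GaloisRep.toLocal v (D.ρq n)) ⊗[ℤ] Gell v)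
    (n : Finset (HeightOneSpectrum (𝓞 K))) (v : HeightOneSpectrum (𝓞 K)) (hv : v ∉ n)
    (z : ↥(D.selmerAt jbar (insert v n)) ⊗[ℤ] Gn (K := K) (insert v n)) :
    ({ D with fs := fs₂ } : LevelData R ρ t N).lowerPath jbar n v hv z = D.lowerPath jbar n v hv z := by
  -- not `rfl` on the whole term (the elaborator would unfold the `G_n` re-bracketing): compare on
  -- pure tensors through the explicit middle term
  have key : ({ D with fs := fs₂ } : LevelData R ρ t N).lowerPath jbar n v hv =
      D.lowerPath jbar n v hv := by
    refine TensorProduct.ext' fun x g => ?_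
    change (TensorProduct.assoc ℤ _ _ _).symm
        (singularMap (GaloisRep.toLocal v (D.ρq (insert v n)))
          (galoisCohomology.localization (D.ρq (insert v n)) (Sum.inr v) 1
            (x : galoisCohomology (D.ρq (insert v n)) 1)) ⊗ₜ[ℤ]
          TensorProduct.comm ℤ _ _ (gnInsertEquiv v n hv g)) = _
    rfl
  exact LinearMap.congr_fun key z

/-- **Unit rescaling of the finite–singular slot transports Kolyvagin systems** (reading note (v) of
lit's `FiniteSingularNatural`, the kernel half of (n2)).  Let `fs₂ = u_ℓ · fs` on the finite classes
at every `(nℓ, ℓ)` (`IsRescaledFs`), with `w_ℓ u_ℓ = 1`; suppose the level Selmer groups are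
`R`-submodules and `fs` is natural along the scalars on the finite classes.  If `κ` satisfies the
(ks relations) for the slot `fs₂`, then `κ″_n := (∏_{ℓ ∣ n} w_ℓ) · κ_n` satisfies them for `fs`.
Proof: with `c_n = ∏_{ℓ∣n} w_ℓ`, upper(`c_n κ_n`) `= c_n ·` upper(`κ_n`), lower(`c_{nℓ} κ_{nℓ}`)
`= c_{nℓ} ·` lower(`κ_{nℓ}`) `= c_{nℓ} u_ℓ ·` upper(`κ_n`), and `c_{nℓ} u_ℓ = c_n w_ℓ u_ℓ = c_n`.
[cite: Howard2004HeegnerKolyvagin, Def. 1.2.3 with display (ks relations); cf. Thm. 1.7.5 (arXiv p. 6 L126 – p. 7 L12; p. 14 L30–44)] -/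
theorem isKolyvaginSystem_smulClasses_of_isRescaledFs (D : LevelData R ρ t N)
    (jbar : AlgebraicClosure K →+* ℂ) (hρ : ρ.IsScalarLinear R) (hst : D.IsSelmerScalarStable jbar hρ)
    (hnat : ∀ (n : Finset (HeightOneSpectrum (𝓞 K))) (v : HeightOneSpectrum (𝓞 K)), v ∉ n →
      insert v n ∈ t.levelSet → D.FsScalarNaturalAt hρ (insert v n) v)
    {fs₂ : ∀ (n : Finset (HeightOneSpectrum (𝓞 K))) (v : HeightOneSpectrum (𝓞 K)),
      galoisCohomology ((D.ρq n).toLocal (Sum.inr v)) 1 →+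
        SingularQuotient (GaloisRep.toLocal v (D.ρq n)) ⊗[ℤ] Gell v}
    {u : HeightOneSpectrum (𝓞 K) → R} (hrel : D.IsRescaledFs hρ fs₂ u)
    (w : HeightOneSpectrum (𝓞 K) → R) (hwu : ∀ v, w v * u v = 1)
    {κ : ∀ n : Finset (HeightOneSpectrum (𝓞 K)), ↥(D.selmerAt jbar n) ⊗[ℤ] Gn (K := K) n}
    (hκ : ({ D with fs := fs₂ } : LevelData R ρ t N).IsKolyvaginSystem jbar κ) :
    D.IsKolyvaginSystem jbar (D.smulClasses jbar hρ hst (fun n => ∏ v ∈ n, w v) κ) := by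
  intro n v hv hn
  have hvP : v ∈ t.primes := mem_primes_of_insert_mem_levelSet hn
  -- (ks) for the slot `fs₂`, read through `D`: `(u_ℓ ⊗ 1 ⊗ 1) upper(κ_n) = lower(κ_{nℓ})`
  have hks : TensorProduct.map (D.sqSMul hρ (insert v n) v (u v)) LinearMap.id
      (D.upperPath jbar n v (κ n)) = D.lowerPath jbar n v hv (κ (insert v n)) := by
    have h := hκ n v hv hn
    rw [D.upperPath_of_isRescaledFs jbar hρ hrel hv hn, lowerPath_with_fs] at h
    exact h
  have hc : (∏ x ∈ insert v n, w x) * u v = ∏ x ∈ n, w x := by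
    rw [Finset.prod_insert hv, mul_comm (w v), mul_assoc, hwu, mul_one]
  refine (D.upperPath_smul jbar hρ hst hv hvP (hnat n v hv hn) _ (κ n)).trans ?_
  refine Eq.trans ?_ (D.lowerPath_smul jbar hρ hst hv _ (κ (insert v n))).symm
  rw [← hks, map_sqSMul_map_sqSMul, hc]

/-- … and `κ″ ∈ KS(T, F, 𝓛; fs)` when `κ ∈ KS(T, F, 𝓛; fs₂)` (the support condition off `𝓝(𝓛)` is
kept). [cite: Howard2004HeegnerKolyvagin, Def. 1.2.3 (arXiv p. 7, L10–12)] -/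
theorem smulClasses_mem_KS_of_isRescaledFs (D : LevelData R ρ t N)
    (jbar : AlgebraicClosure K →+* ℂ) (hρ : ρ.IsScalarLinear R) (hst : D.IsSelmerScalarStable jbar hρ)
    (hnat : ∀ (n : Finset (HeightOneSpectrum (𝓞 K))) (v : HeightOneSpectrum (𝓞 K)), v ∉ n →
      insert v n ∈ t.levelSet → D.FsScalarNaturalAt hρ (insert v n) v)
    {fs₂ : ∀ (n : Finset (HeightOneSpectrum (𝓞 K))) (v : HeightOneSpectrum (𝓞 K)),
      galoisCohomology ((D.ρq n).toLocal (Sum.inr v)) 1 →+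
        SingularQuotient (GaloisRep.toLocal v (D.ρq n)) ⊗[ℤ] Gell v}
    {u : HeightOneSpectrum (𝓞 K) → R} (hrel : D.IsRescaledFs hρ fs₂ u)
    (w : HeightOneSpectrum (𝓞 K) → R) (hwu : ∀ v, w v * u v = 1)
    {κ : ∀ n : Finset (HeightOneSpectrum (𝓞 K)), ↥(D.selmerAt jbar n) ⊗[ℤ] Gn (K := K) n}
    (hκ : κ ∈ ({ D with fs := fs₂ } : LevelData R ρ t N).KS jbar) :
    D.smulClasses jbar hρ hst (fun n => ∏ v ∈ n, w v) κ ∈ D.KS jbar :=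
  ⟨D.isKolyvaginSystem_smulClasses_of_isRescaledFs jbar hρ hst hnat hrel w hwu hκ.1,
    fun n hn => by
      have h0 : κ n = 0 := hκ.2 n hn
      rw [smulClasses_apply, h0, map_zero]⟩

/-- The rescaling fixes the bottom class: `κ″_1 = κ_1` (empty product).
[cite: Howard2004HeegnerKolyvagin, Def. 1.2.3 (arXiv p. 7, L1–6)] -/
theorem smulClasses_prod_empty (D : LevelData R ρ t N) (jbar : AlgebraicClosure K →+* ℂ)
    (hρ : ρ.IsScalarLinear R) (hst : D.IsSelmerScalarStable jbar hρ) (w : HeightOneSpectrum (𝓞 K) → R)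
    (κ : ∀ n : Finset (HeightOneSpectrum (𝓞 K)), ↥(D.selmerAt jbar n) ⊗[ℤ] Gn (K := K) n) :
    D.smulClasses jbar hρ hst (fun n => ∏ v ∈ n, w v) κ ∅ = κ ∅ :=
  D.smulClasses_apply_of_eq_one jbar hρ hst _ κ Finset.prod_empty

end LevelData

/-! ## 4. All levels: rescaling a `DVRSetting.KolyvaginSystem` -/

section TowerScalars

variable {K : Type} [Field K] {R A : Type} [CommRing R] [CommRing A] [Algebra R A]
  {P : Type} [AddCommGroup P] [TopologicalSpace P] [DiscreteTopology P] [Module A P] [Module R P]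
  [IsScalarTower R A P] {ρ : DiscreteGaloisModule K P}

/-- An `A`-linear discrete module is `R`-linear along `R → A` (`IsScalarTower`; e.g. the levels
`T^{(k)}` over `R_k = R/𝔪^{e_k}` are `R`-linear).
[cite: Howard2004HeegnerKolyvagin, §1 conventions `Mod_{R,K}` and §1.6 (arXiv p. 5 L3–24, p. 11 L13–16)] -/
theorem _root_.Literature.NumberTheory.GaloisRepresentations.DiscreteGaloisModule.IsScalarLinear.of_isScalarTower
    (h : ρ.IsScalarLinear A) : ρ.IsScalarLinear R := by
  intro σ r x
  rw [← algebraMap_smul A r x, h, algebraMap_smul]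

/-- `H¹(algebraMap r •) = H¹(r •)`: the scalar action through `R → A` is the `R`-action.
[cite: Howard2004HeegnerKolyvagin, §1.6 (arXiv p. 11, L13–16)] -/
theorem _root_.Literature.NumberTheory.GaloisRepresentations.galoisCohomology.scalarMapH1_algebraMap
    (h : ρ.IsScalarLinear A) (r : R) :
    scalarMapH1 ρ h (algebraMap R A r) = scalarMapH1 ρ (h.of_isScalarTower (R := R)) r := by
  have : scalarIntertwining ρ h (algebraMap R A r) = scalarIntertwining ρ (h.of_isScalarTower (R := R)) r :=
    ContIntertwiningMap.ext (ContinuousLinearMap.ext fun x => algebraMap_smul A r x)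
  unfold scalarMapH1 scalarMap
  rw [this]

end TowerScalars

section DVR

variable {p : ℕ} [Fact p.Prime] {K : Type} [Field K] [NumberField K]
  {R : Type} [CommRing R] [IsDomain R] [IsDiscreteValuationRing R] [Algebra ℤ_[p] R]
  {N : ℕ → Type} [∀ k, AddCommGroup (N k)] [∀ k, TopologicalSpace (N k)]
  [∀ k, DiscreteTopology (N k)] [∀ k, Module R (N k)]
  {Rk : ℕ → Type} [∀ k, CommRing (Rk k)] [∀ k, IsLocalRing (Rk k)] [∀ k, TopologicalSpace (Rk k)]
  [∀ k, DiscreteTopology (Rk k)] [∀ k, Algebra ℤ_[p] (Rk k)] [∀ k, Algebra R (Rk k)]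
  [∀ k, Module (Rk k) (N k)] [∀ k, IsScalarTower R (Rk k) (N k)]
  {Nbar : Type} [AddCommGroup Nbar] [TopologicalSpace Nbar] [DiscreteTopology Nbar]
  [∀ k, Module (Rk k) Nbar]
  {Nq : ℕ → Finset (HeightOneSpectrum (𝓞 K)) → Type} [∀ k n, AddCommGroup (Nq k n)]
  [∀ k n, TopologicalSpace (Nq k n)] [∀ k n, DiscreteTopology (Nq k n)]
  [∀ k n, Module (Rk k) (Nq k n)] [∀ k n, Module R (Nq k n)]
  [∀ k n, IsScalarTower R (Rk k) (Nq k n)]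

namespace DVRSetting

/-- The reduction `H¹(K, T^{(k+1)}/I_n) → H¹(K, T^{(k)}/I_n)` commutes with the scalars of `R`
(read at the two levels through `R → R_{k+1}`, `R → R_k`). [cite: Howard2004HeegnerKolyvagin, §1.6 (arXiv p. 11, L45–50)] -/
theorem rqH1_scalarMapH1 (S : DVRSetting p K R N Rk Nbar Nq)
    (hlin : ∀ k, (S.T.ρ k).IsScalarLinear (Rk k)) (k : ℕ) (n : Finset (HeightOneSpectrum (𝓞 K)))
    (r : R) (x : galoisCohomology ((S.LD (k + 1)).ρq n) 1) :
    S.rqH1 k n (scalarMapH1 ((S.LD (k + 1)).ρq n) ((S.LD (k + 1)).isScalarLinear (hlin (k + 1)) n)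
        (algebraMap R (Rk (k + 1)) r) x) =
      scalarMapH1 ((S.LD k).ρq n) ((S.LD k).isScalarLinear (hlin k) n) (algebraMap R (Rk k) r)
        (S.rqH1 k n x) := by
  rw [scalarMapH1_algebraMap, scalarMapH1_algebraMap]
  exact cohomologyMap_scalarMapH1 _ _ (S.rq k n) (S.rq_equivariant k n) r x

/-- Tensor bookkeeping: `(F ⊗ 1) ∘ (σ_A ⊗ 1) = (σ_B ⊗ 1) ∘ (F ⊗ 1)` when `F ∘ σ_A = σ_B ∘ F`. [folklore] -/
private theorem map_map_of_comp_eq {A B G : Type} [AddCommGroup A] [AddCommGroup B]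
    {_ : AddCommMonoid G} {_ : Module ℤ G} (F : A →+ B) (σA : A →+ A) (σB : B →+ B)
    (h : F.comp σA = σB.comp F) (x : A ⊗[ℤ] G) :
    TensorProduct.map F.toIntLinearMap LinearMap.id
        (TensorProduct.map σA.toIntLinearMap LinearMap.id x) =
      TensorProduct.map σB.toIntLinearMap LinearMap.id
        (TensorProduct.map F.toIntLinearMap LinearMap.id x) := by
  induction x using TensorProduct.induction_on with
  | zero => simp only [map_zero]
  | add x y hx hy => simp only [map_add, hx, hy]
  | tmul a g =>
    simp only [TensorProduct.map_tmul, AddMonoidHom.coe_toIntLinearMap, LinearMap.id_coe, id_eq]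
    rw [← AddMonoidHom.comp_apply, h, AddMonoidHom.comp_apply]

/-- **Rescaling a Kolyvagin system of the DVR-level triple.**  Let `κ = (κ^{(k)}_n)` be level classes
of `S` satisfying the (ks relations) at every level for the SLOTS `fs₂ = u_ℓ · fs` (`u_ℓ ∈ R` read in
`R_k`, `w_ℓ u_ℓ = 1`; `IsRescaledFs` at every level), compatible under the reductions and with bottom
class `one ∈ H¹_F(K, T) = lim` — i.e. the data of a `KolyvaginSystem` of the setting «`S` with the
slots `fs₂`», unbundled.  If the slots `fs` of `S` are natural along the scalars on the finite classes
and the level Selmer groups are `R_k`-submodules, then `κ″^{(k)}_n := (∏_{ℓ ∣ n} w_ℓ) · κ^{(k)}_n` IS a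
Kolyvagin system of `S` (for the slots `fs`) with THE SAME bottom class `κ″_1 = κ_1 = one` — so the
conclusion of Thm. 1.6.1 for `S`, which mentions only `κ_1`, is available for `κ`.
[cite: Howard2004HeegnerKolyvagin, Def. 1.2.3 and Thm. 1.6.1 (arXiv p. 7 L1–12, p. 11 L23–28); cf. Thm. 1.7.5 (p. 14, L30–44)] -/
theorem exists_kolyvaginSystem_smul_of_isRescaledFs (S : DVRSetting p K R N Rk Nbar Nq)
    (hlin : ∀ k, (S.T.ρ k).IsScalarLinear (Rk k))
    (hst : ∀ k, (S.LD k).IsSelmerScalarStable S.jbar (hlin k))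
    (hnat : ∀ k (n : Finset (HeightOneSpectrum (𝓞 K))) (v : HeightOneSpectrum (𝓞 K)), v ∉ n →
      insert v n ∈ (S.t k).levelSet → (S.LD k).FsScalarNaturalAt (hlin k) (insert v n) v)
    (fs₂ : ∀ k (n : Finset (HeightOneSpectrum (𝓞 K))) (v : HeightOneSpectrum (𝓞 K)),
      galoisCohomology (((S.LD k).ρq n).toLocal (Sum.inr v)) 1 →+
        SingularQuotient (GaloisRep.toLocal v ((S.LD k).ρq n)) ⊗[ℤ] Gell v)
    (u w : HeightOneSpectrum (𝓞 K) → R) (hwu : ∀ v, w v * u v = 1)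
    (hrel : ∀ k, (S.LD k).IsRescaledFs (hlin k) (fs₂ k) fun v => algebraMap R (Rk k) (u v))
    (κ : ∀ k (n : Finset (HeightOneSpectrum (𝓞 K))), ↥((S.LD k).selmerAt S.jbar n) ⊗[ℤ] Gn (K := K) n)
    (hks : ∀ k, κ k ∈ ({ S.LD k with fs := fs₂ k } : LevelData (Rk k) (S.T.ρ k) (S.t k) (Nq k)).KS S.jbar)
    (hred : ∀ k n,
      TensorProduct.map ((S.rqH1 k n).comp ((S.LD (k + 1)).selmerAt S.jbar n).subtype).toIntLinearMap
          LinearMap.id (κ (k + 1) n) =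
        TensorProduct.map ((S.LD k).selmerAt S.jbar n).subtype.toIntLinearMap LinearMap.id (κ k n))
    (one : ∀ k, galoisCohomology (S.T.ρ k) 1) (hone : one ∈ S.T.limitSelmer fun k => (S.t k).cond)
    (hκone : ∀ k, TensorProduct.map ((S.LD k).selmerAt S.jbar ∅).subtype.toIntLinearMap LinearMap.id
        (κ k ∅) =
      ((S.LD k).isQuotientBy ∅).cohomologyMap 1 (one k) ⊗ₜ[ℤ] (gnEmptyEquiv (K := K)).symm 1) :
    ∃ κ' : S.KolyvaginSystem, κ'.one = one ∧ ∀ k n, κ'.κ k n =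
      (S.LD k).smulClasses S.jbar (hlin k) (hst k) (fun n => ∏ v ∈ n, algebraMap R (Rk k) (w v))
        (κ k) n := by
  have hwu' : ∀ k v, algebraMap R (Rk k) (w v) * algebraMap R (Rk k) (u v) = 1 := fun k v => by
    simpa using congrArg (algebraMap R (Rk k)) (hwu v)
  have hc : ∀ k' (n : Finset (HeightOneSpectrum (𝓞 K))),
      (∏ v ∈ n, algebraMap R (Rk k') (w v)) = algebraMap R (Rk k') (∏ v ∈ n, w v) :=
    fun k' n => (map_prod (algebraMap R (Rk k')) _ _).symm
  refine ⟨{ κ := fun k => (S.LD k).smulClasses S.jbar (hlin k) (hst k)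
              (fun n => ∏ v ∈ n, algebraMap R (Rk k) (w v)) (κ k)
            ks := fun k => (S.LD k).smulClasses_mem_KS_of_isRescaledFs S.jbar (hlin k) (hst k)
              (hnat k) (hrel k) _ (hwu' k) (hks k)
            κ_red := fun k n => ?_
            one := one
            one_mem := hone
            κ_one := fun k => ?_ }, rfl, fun k n => rfl⟩
  · -- compatibility with the reductions: `rqH1` commutes with the (level-independent) scalars
    have h1 : ((S.rqH1 k n).comp ((S.LD (k + 1)).selmerAt S.jbar n).subtype).comp
        ((S.LD (k + 1)).selmerAtSMul S.jbar (hlin (k + 1)) (hst (k + 1)) n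
          (∏ v ∈ n, algebraMap R (Rk (k + 1)) (w v))) =
        (scalarMapH1 ((S.LD k).ρq n) ((S.LD k).isScalarLinear (hlin k) n)
            (∏ v ∈ n, algebraMap R (Rk k) (w v))).comp
          ((S.rqH1 k n).comp ((S.LD (k + 1)).selmerAt S.jbar n).subtype) := by
      refine AddMonoidHom.ext fun x => ?_
      change S.rqH1 k n (((S.LD (k + 1)).selmerAtSMul S.jbar (hlin (k + 1)) (hst (k + 1)) n
          (∏ v ∈ n, algebraMap R (Rk (k + 1)) (w v)) x : ↥((S.LD (k + 1)).selmerAt S.jbar n)) :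
            galoisCohomology ((S.LD (k + 1)).ρq n) 1) =
        scalarMapH1 ((S.LD k).ρq n) ((S.LD k).isScalarLinear (hlin k) n)
          (∏ v ∈ n, algebraMap R (Rk k) (w v)) (S.rqH1 k n (x : galoisCohomology ((S.LD (k + 1)).ρq n) 1))
      rw [LevelData.coe_selmerAtSMul, hc, hc, S.rqH1_scalarMapH1 hlin]
    have h2 : ((S.LD k).selmerAt S.jbar n).subtype.comp
        ((S.LD k).selmerAtSMul S.jbar (hlin k) (hst k) n (∏ v ∈ n, algebraMap R (Rk k) (w v))) =
        (scalarMapH1 ((S.LD k).ρq n) ((S.LD k).isScalarLinear (hlin k) n)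
            (∏ v ∈ n, algebraMap R (Rk k) (w v))).comp ((S.LD k).selmerAt S.jbar n).subtype :=
      AddMonoidHom.ext fun _ => rfl
    refine (map_map_of_comp_eq _ _ _ h1 (κ (k + 1) n)).trans ?_
    refine (congrArg (TensorProduct.map (scalarMapH1 ((S.LD k).ρq n)
      ((S.LD k).isScalarLinear (hlin k) n) (∏ v ∈ n, algebraMap R (Rk k) (w v))).toIntLinearMap
        LinearMap.id) (hred k n)).trans ?_
    exact (map_map_of_comp_eq _ _ _ h2 (κ k n)).symm
  · -- the bottom class: `c(1) = 1`
    rw [LevelData.smulClasses_prod_empty]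
    exact hκone k

/-- The conclusion of Thm. 1.6.1 does not mention the finite–singular slots: it is the same
proposition for `S` and for `S` with any other slots. [cite: Howard2004HeegnerKolyvagin, Thm. 1.6.1 (arXiv p. 11, L23–28)] -/
theorem conclusion_with_fs_iff (S : DVRSetting p K R N Rk Nbar Nq)
    (fs₂ : ∀ k (n : Finset (HeightOneSpectrum (𝓞 K))) (v : HeightOneSpectrum (𝓞 K)),
      galoisCohomology (((S.LD k).ρq n).toLocal (Sum.inr v)) 1 →+
        SingularQuotient (GaloisRep.toLocal v ((S.LD k).ρq n)) ⊗[ℤ] Gell v)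
    (hy : S.SatisfiesH)
    (hy₂ : ({ S with LD := fun k => { S.LD k with fs := fs₂ k } } : DVRSetting p K R N Rk Nbar Nq).SatisfiesH)
    (one : ∀ k, galoisCohomology (S.T.ρ k) 1) :
    ({ S with LD := fun k => { S.LD k with fs := fs₂ k } } : DVRSetting p K R N Rk Nbar Nq).Conclusion
        hy₂ one ↔ S.Conclusion hy one :=
  Iff.rfl

end DVRSetting

end DVR

end Literature.NumberTheory.GaloisCohomology.Howard2004

end
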